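import Mathlib
import Summits.ResolutionOfSingularities.ResolutionOfSingularities.Theorems.WeightedInvariantLocalWeightedDropPureDescentNewton
import Summits.ResolutionOfSingularities.ResolutionOfSingularities.Theorems.WeightedInvariantLocalWeightedDropMonicDescentShearRecentre
import Summits.ResolutionOfSingularities.ResolutionOfSingularities.Theorems.WeightedInvariantLocalWeightedDropWildPurePowerClean
import Literature.AlgebraicGeometry.Resolution.FormalShear

/-!
# `WeightedInvariant.LocalWeightedDrop`, stub S3πM: the pure-power polyhedron descent — the CLEANED SHEAR (CJS Lemma 13.6) and `β` NON-INCREASING ALONG Σ**_q (CJS Prop. 13.5 / Lemma 13.4 (3)); β-stabilisation (pieces P-S, P-β)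

Crux item stmt-ResolutionOfSingularities-8899 `LocalWeightedDrop` (route `ResolutionOfSingularities/WeightedInvariant`), registered skeleton v29
(4058ce51dfd2e5c8), stub S3πM `stub_wildPurelyInseparableReductionWon`.  [OURS · L1 W4.3, chain w43, lead prover (gen 3); a LINE UNDER THE STUB: the
pure-power polyhedron descent (second key to S3πM), MODEL Cossart–Jannsen–Saito LNM 2270 Ch. 11–13 for `J = (y^q + A)`, `e = 2`, `k = k̄` — the
degree-2 instance is the landed key N4″ (`…Theorems.MonicDescent*`); nothing here is a statement of any manuscript.]

* algebra of `MonicDescent.shear h A = A(u₁, u₂ + u₁h)` for one series (`shear_add/pow/C`, order, positions, `u₁^q ∣ ·` kept);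
* THE LEFTMOST COLUMN IS KEPT: `coeff_shear_of_le_alphaL`, `alphaL_shear`, `betaL_shear`; THE CLEANED SHEAR OF A CLEAN LABEL: `clean_shear_spec` —
  non-empty support, same `α`, same `β` (the lex-min vertex is off the lattice and survives);
* CLEANING IS A RE-CENTRING over a perfect field (`exists_clean_eq_add_pow`, from `…WildPurePowerClean.exists_clean` p483848), hence
  `clean ∘ shear ∘ clean = clean ∘ shear` (`clean_shear_clean`, `clean_shear_clean_shear`): the cleaned labels of Σ**_q compose their shears additively;
* `betaL_succ_le` — for a clean non-zero position `A` and `A' ∈ succ q A`: `β(A') ≤ β(A)`, with equality only at the blow-up of the permissible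
  `V(y,u₁)` or at a point move answered by `(1:0)` / `(1:λ)` — characteristic-free; `IsNeutralStep`; `exists_neutral_tail` — β stabilises along an
  infinite Σ**_q-chain and the tail is β-neutral (degree-2 instances `MonicDescent.betaL_succLabels_le` p490378, `…exists_neutral_tail` p491410).
-/

set_option linter.dupNamespace false -- mandated namespace of this single-conjunct summit

noncomputable section

namespace Summit.ResolutionOfSingularities.ResolutionOfSingularities.Theorems

namespace PureDescent

open MvPowerSeries MonicDescent Literature.RingTheory.TwoVariableSeries Literature.AlgebraicGeometry.Resolution

variable {k : Type} [Field k]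

/-! ## Algebra of the `u₂`-shear `A ↦ A(u₁, u₂ + u₁h)` (one series) -/

/-- The shear is additive. -/
theorem shear_add (h A B : MvPowerSeries (Fin 2) k) : shear h (A + B) = shear h A + shear h B := by
  rw [shear_eq, shear_eq, shear_eq, ← coe_substAlgHom (hasSubst_of_constantCoeff_zero (constantCoeff_shearFamily h)), map_add]

/-- The shear of a power. -/
theorem shear_pow (h A : MvPowerSeries (Fin 2) k) (n : ℕ) : shear h (A ^ n) = shear h A ^ n := by
  rw [shear_eq, shear_eq, ← coe_substAlgHom (hasSubst_of_constantCoeff_zero (constantCoeff_shearFamily h)), map_pow]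

/-- The shear fixes constants. -/
theorem shear_C (h : MvPowerSeries (Fin 2) k) (c : k) : shear h (C c) = C c := by
  rw [shear_eq, subst_C]

/-- The shear does not lower the order. -/
theorem order_le_order_shear (h A : MvPowerSeries (Fin 2) k) : A.order ≤ (shear h A).order := by
  rw [shear_eq]
  exact FormalShear.order_le_order_subst' _ (constantCoeff_shearFamily h) A

/-- The shear of a position is a position. -/
theorem isPosition_shear {q : ℕ} (h : MvPowerSeries (Fin 2) k) {A : MvPowerSeries (Fin 2) k} (hA : IsPosition q A) :
    IsPosition q (shear h A) :=
  lt_of_lt_of_le hA (order_le_order_shear h A)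

/-- The shear keeps a zero constant coefficient. -/
theorem constantCoeff_shear_eq_zero (h : MvPowerSeries (Fin 2) k) {A : MvPowerSeries (Fin 2) k} (hA : constantCoeff A = 0) :
    constantCoeff (shear h A) = 0 := by
  have h1 : (1 : ℕ∞) ≤ (shear h A).order :=
    le_trans (one_le_order_iff_constCoeff_eq_zero.mpr hA |> fun h => by simpa using h) (order_le_order_shear h A)
  have := one_le_order_iff_constCoeff_eq_zero.mp (by simpa using h1)
  simpa using this

/-- `u₁^q ∣ A` is kept by the shear (`u₁` is fixed). -/
theorem isPermissibleOne_shear {q : ℕ} (h : MvPowerSeries (Fin 2) k) {A : MvPowerSeries (Fin 2) k} (hA : IsPermissibleOne q A) :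
    IsPermissibleOne q (shear h A) :=
  le_fst_shear_of_le_fst h A q hA

/-! ## The leftmost column under the shear (CJS Lemma 13.6): `α`, `β` and the lex-min point are kept -/

/-- The columns `P₀ ≤ α` are untouched by the shear. -/
theorem coeff_shear_of_le_alphaL (h A : MvPowerSeries (Fin 2) k) {d : Fin 2 →₀ ℕ} (hd : d 0 ≤ alphaL (nset A)) :
    coeff d (shear h A) = coeff d A :=
  coeff_shear_of_le (h := h) A (alphaL (nset A)) (fun _ he => alphaL_le he) d hd

/-- Membership in the support, columns `P₀ ≤ α`. -/
theorem mem_nset_shear_iff_of_le_alphaL (h A : MvPowerSeries (Fin 2) k) {d : Fin 2 →₀ ℕ} (hd : d 0 ≤ alphaL (nset A)) :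
    d ∈ nset (shear h A) ↔ d ∈ nset A := by
  rw [mem_nset_iff, mem_nset_iff, coeff_shear_of_le_alphaL h A hd]

/-- Every support point of the sheared series has `P₀ ≥ α`. -/
theorem alphaL_le_fst_of_mem_nset_shear (h A : MvPowerSeries (Fin 2) k) {d : Fin 2 →₀ ℕ} (hd : d ∈ nset (shear h A)) :
    alphaL (nset A) ≤ d 0 :=
  le_fst_shear_of_le_fst h A (alphaL (nset A)) (fun _ he => alphaL_le he) d hd

/-- `α` IS KEPT by the shear. -/
theorem alphaL_shear (h : MvPowerSeries (Fin 2) k) {A : MvPowerSeries (Fin 2) k} (hne : (nset A).Nonempty) :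
    alphaL (nset (shear h A)) = alphaL (nset A) := by
  obtain ⟨P, hP, hP0⟩ := exists_eq_alphaL hne
  have hPS : P ∈ nset (shear h A) := (mem_nset_shear_iff_of_le_alphaL h A hP0.le).mpr hP
  apply le_antisymm
  · rw [← hP0]; exact alphaL_le hPS
  · obtain ⟨Q, hQ, hQ0⟩ := exists_eq_alphaL (⟨P, hPS⟩ : (nset (shear h A)).Nonempty)
    rw [← hQ0]; exact alphaL_le_fst_of_mem_nset_shear h A hQ

/-- `β` IS KEPT by the shear. -/
theorem betaL_shear (h : MvPowerSeries (Fin 2) k) {A : MvPowerSeries (Fin 2) k} (hne : (nset A).Nonempty) :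
    betaL (nset (shear h A)) = betaL (nset A) := by
  have hα := alphaL_shear h hne
  obtain ⟨P, hP, hP0, hP1⟩ := exists_eq_betaL hne
  have hPS : P ∈ nset (shear h A) := (mem_nset_shear_iff_of_le_alphaL h A hP0.le).mpr hP
  apply le_antisymm
  · rw [← hP1]; exact betaL_le hPS (by rw [hα]; exact hP0)
  · obtain ⟨Q, hQ, hQ0, hQ1⟩ := exists_eq_betaL (⟨P, hPS⟩ : (nset (shear h A)).Nonempty)
    rw [hα] at hQ0
    have hQA : Q ∈ nset A := (mem_nset_shear_iff_of_le_alphaL h A hQ0.le).mp hQ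
    rw [← hQ1]; exact betaL_le hQA hQ0

/-! ## The CLEANED shear of a clean label: `α`, `β` kept, support non-empty -/

/-- For a CLEAN label, the columns `P₀ ≤ α` survive shearing AND cleaning. -/
theorem mem_nset_clean_shear_iff_of_le_alphaL {q : ℕ} (h : MvPowerSeries (Fin 2) k) {A : MvPowerSeries (Fin 2) k}
    (hc : IsClean q A) {d : Fin 2 →₀ ℕ} (hd : d 0 ≤ alphaL (nset A)) :
    d ∈ nset (clean q (shear h A)) ↔ d ∈ nset A := by
  rw [mem_nset_clean_iff, mem_nset_shear_iff_of_le_alphaL h A hd]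
  constructor
  · exact fun hh => hh.1
  · intro hdA
    refine ⟨hdA, fun hdiv => ?_⟩
    exact (mem_nset_iff A d).mp hdA (hc d hdiv)

/-- Every support point of the cleaned sheared series has `P₀ ≥ α`. -/
theorem alphaL_le_fst_of_mem_nset_clean_shear {q : ℕ} (h A : MvPowerSeries (Fin 2) k) {d : Fin 2 →₀ ℕ}
    (hd : d ∈ nset (clean q (shear h A))) : alphaL (nset A) ≤ d 0 :=
  alphaL_le_fst_of_mem_nset_shear h A (nset_clean_subset q _ hd)

/-- THE CLEANED SHEAR OF A CLEAN NON-ZERO LABEL: non-empty support, same `α`, same `β` (the lex-min vertex `(α, β)` is off the lattice,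
so it survives; CJS Lemma 13.6 + Lemma 11.4 for `J = (y^q + A)`). -/
theorem clean_shear_spec {q : ℕ} (h : MvPowerSeries (Fin 2) k) {A : MvPowerSeries (Fin 2) k} (hc : IsClean q A)
    (hne : (nset A).Nonempty) :
    (nset (clean q (shear h A))).Nonempty ∧ alphaL (nset (clean q (shear h A))) = alphaL (nset A) ∧
      betaL (nset (clean q (shear h A))) = betaL (nset A) := by
  obtain ⟨P, hP, hP0, hP1⟩ := exists_eq_betaL hne
  have hPS : P ∈ nset (clean q (shear h A)) := (mem_nset_clean_shear_iff_of_le_alphaL h hc hP0.le).mpr hP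
  have hneS : (nset (clean q (shear h A))).Nonempty := ⟨P, hPS⟩
  have hα : alphaL (nset (clean q (shear h A))) = alphaL (nset A) := by
    apply le_antisymm
    · rw [← hP0]; exact alphaL_le hPS
    · obtain ⟨Q, hQ, hQ0⟩ := exists_eq_alphaL hneS
      rw [← hQ0]; exact alphaL_le_fst_of_mem_nset_clean_shear h A hQ
  refine ⟨hneS, hα, ?_⟩
  apply le_antisymm
  · rw [← hP1]; exact betaL_le hPS (by rw [hα]; exact hP0)
  · obtain ⟨Q, hQ, hQ0, hQ1⟩ := exists_eq_betaL hneS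
    rw [hα] at hQ0
    have hQA : Q ∈ nset A := (mem_nset_clean_shear_iff_of_le_alphaL h hc hQ0.le).mp hQ
    rw [← hQ1]; exact betaL_le hQA hQ0

/-- In particular the cleaned shear of a clean non-zero label is non-zero. -/
theorem clean_shear_ne_zero {q : ℕ} (h : MvPowerSeries (Fin 2) k) {A : MvPowerSeries (Fin 2) k} (hc : IsClean q A) (hA : A ≠ 0) :
    clean q (shear h A) ≠ 0 :=
  (nset_nonempty_iff _).mp (clean_shear_spec h hc ((nset_nonempty_iff A).mpr hA)).1

/-! ## Cleaning is a re-centring (perfect fields) and commutes with the shear up to re-centring -/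

/-- Over a perfect field of characteristic `p`, the clean part of a series `B` with `B(0) = 0` is a RE-CENTRING of it:
`clean q B = B + φ^q` for some `φ` with `φ(0) = 0` (`q = p^e`; Hauser–Perlega cleaning, `…WildPurePowerClean.exists_clean`). -/
theorem exists_clean_eq_add_pow (p : ℕ) (hp : p.Prime) [CharP k p] [PerfectRing k p] (e : ℕ) (B : MvPowerSeries (Fin 2) k)
    (hB : constantCoeff B = 0) :
    ∃ φ : MvPowerSeries (Fin 2) k, constantCoeff φ = 0 ∧ clean (p ^ e) B = B + φ ^ (p ^ e) := by
  obtain ⟨φ, hφ0, hcl⟩ := WildPurePower.exists_clean p hp e B hB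
  refine ⟨φ, hφ0, ?_⟩
  have hc : IsClean (p ^ e) (B + φ ^ (p ^ e)) := hcl
  rw [← clean_eq_self_of_isClean hc, clean_add_pow p hp e]

/-- CLEAN ∘ SHEAR ∘ CLEAN = CLEAN ∘ SHEAR (perfect field, `B(0) = 0`): re-centrings commute with the shear and die under cleaning. -/
theorem clean_shear_clean (p : ℕ) (hp : p.Prime) [CharP k p] [PerfectRing k p] (e : ℕ) (g B : MvPowerSeries (Fin 2) k)
    (hB : constantCoeff B = 0) :
    clean (p ^ e) (shear g (clean (p ^ e) B)) = clean (p ^ e) (shear g B) := by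
  obtain ⟨φ, -, hφ⟩ := exists_clean_eq_add_pow p hp e B hB
  rw [hφ, shear_add, shear_pow, clean_add_pow p hp e]

/-- Sheared composition for the cleaned labels of Σ**_q: `clean(shear_a (clean (shear_b A))) = clean (shear_{a + b} A)` for `b = b(u₁)`
(perfect field; `A(0) = 0`). -/
theorem clean_shear_clean_shear (p : ℕ) (hp : p.Prime) [CharP k p] [PerfectRing k p] (e : ℕ) (a b A : MvPowerSeries (Fin 2) k)
    (hb : ∀ d : Fin 2 →₀ ℕ, d 1 ≠ 0 → coeff d b = 0) (hA : constantCoeff A = 0) :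
    clean (p ^ e) (shear a (clean (p ^ e) (shear b A))) = clean (p ^ e) (shear (a + b) A) := by
  rw [clean_shear_clean p hp e a (shear b A) (constantCoeff_shear_eq_zero b hA), shear_shear_of_noY a b A hb]

end PureDescent

end Summit.ResolutionOfSingularities.ResolutionOfSingularities.Theorems


namespace Summit.ResolutionOfSingularities.ResolutionOfSingularities.Theorems

namespace PureDescent

open MvPowerSeries MonicDescent Literature.RingTheory.TwoVariableSeries Literature.AlgebraicGeometry.Resolution

variable {k : Type} [Field k]

/-! ## `β` is non-increasing along Σ**_q; the `β`-neutral steps -/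

/-- `β` IS NON-INCREASING ALONG Σ**_q, and the `β`-neutral steps are exactly: the blow-up of the permissible `V(y,u₁)`, or a point move answered
by `(1:0)` or `(1:λ)` (CJS Prop. 13.5 + Lemma 13.4 (3) for the positional strategy on clean positions of `y^q + A`; the degree-2 instance is
`MonicDescent.betaL_succLabels_le`, p490378).  Characteristic-free: only cleanness of `A` is used. -/
theorem betaL_succ_le {q : ℕ} (hq : 0 < q) (A : MvPowerSeries (Fin 2) k) (hc : IsClean q A) (hpos : IsPosition q A) (hA : A ≠ 0)
    (A' : MvPowerSeries (Fin 2) k) (hA' : A' ∈ succ q A) :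
    betaL (nset A') ≤ betaL (nset A) ∧
    (betaL (nset A') = betaL (nset A) →
      (IsPermissibleOne q A ∧ A' = divOne q A) ∨
      (¬ IsPermissibleOne q A ∧ ¬ IsPermissibleTwo q A ∧ ¬ HasGraphCurve q A ∧
        (A' = blowOne q A ∨ ∃ c : k, c ≠ 0 ∧ A' = blowOne q (clean q (shear (C c) A))))) := by
  have hne : (nset A).Nonempty := (nset_nonempty_iff A).mpr hA
  have hsum := le_sum_of_isPosition hpos
  have hsum1 := succ_le_sum_of_isPosition hpos
  by_cases h1 : IsPermissibleOne q A
  · -- (a′) blow up `V(y,u₁)`: `β′ = β`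
    rw [succ_of_isPermissibleOne h1] at hA'
    rcases hA' with rfl
    rw [nset_divOne q A h1, betaL_image_shift (shiftOneQ_fst h1) (shiftOneQ_snd q A) hne]
    exact ⟨le_rfl, fun _ => Or.inl ⟨h1, rfl⟩⟩
  by_cases h2 : IsPermissibleTwo q A
  · -- (a′) blow up `V(y,u₂)`: `β′ = β − q < β`
    rw [succ_of_isPermissibleTwo h1 h2] at hA'
    rcases hA' with rfl
    have hβ := betaL_image_shift₂_add (shiftTwoQ_fst q A) (shiftTwoQ_snd h2) hne
    rw [nset_divTwo q A h2]
    obtain ⟨P, hP, hP0, hP1⟩ := exists_eq_betaL hne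
    have hβq : q ≤ betaL (nset A) := by rw [← hP1]; exact h2 P hP
    exact ⟨by omega, fun h => by omega⟩
  by_cases h3 : HasGraphCurve q A
  · -- (a″) shear, clean, blow up `V(y, ũ₂)`: `β′ = β − q < β`
    rw [succ_of_hasGraphCurve h1 h2 h3] at hA'
    rcases hA' with rfl
    set h := graphShear q A with hh
    have hperm : IsPermissibleTwo q (clean q (shear h A)) := (graphShear_spec h3).2
    obtain ⟨hneB, hαB, hβB⟩ := clean_shear_spec h hc hne
    set B := clean q (shear h A) with hB
    have hβ := betaL_image_shift₂_add (shiftTwoQ_fst q B) (shiftTwoQ_snd hperm) hneB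
    rw [nset_divTwo q B hperm]
    obtain ⟨P, hP, hP0, hP1⟩ := exists_eq_betaL hneB
    have hβq : q ≤ betaL (nset B) := by rw [← hP1]; exact hperm P hP
    rw [hβB] at hβ hβq
    exact ⟨by omega, fun h => by omega⟩
  -- (b) the point move
  rw [succ_of_point h1 h2 h3] at hA'
  have hα : alphaL (nset A) < q := alphaL_lt_of_not_isPermissibleOne h1
  rcases hA' with (rfl | rfl) | ⟨c, hc0, rfl⟩
  · -- (1:0): `β′ = γ⁻ ≤ β`
    rw [nset_blowOne q A hsum]
    exact ⟨betaL_image_psiC_le hsum hne, fun _ => Or.inr ⟨h1, h2, h3, Or.inl rfl⟩⟩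
  · -- (0:1): `β′ = α + β − q < β` since `α < q`
    rw [nset_blowTwo q A hsum, betaL_image_phiEC hsum hne]
    obtain ⟨P, hP, hP0, hP1⟩ := exists_eq_betaL hne
    have h3P := hsum1 P hP
    rw [hP0, hP1] at h3P
    exact ⟨by omega, fun h => by omega⟩
  · -- (1:λ): shear by `λ`, clean, `(1:0)`: `β′ = γ⁻(cleaned) ≤ β`
    obtain ⟨hneB, hαB, hβB⟩ := clean_shear_spec (C c) hc hne
    set B := clean q (shear (C c) A) with hB
    have hposB : IsPosition q B := isPosition_clean (isPosition_shear (C c) hpos)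
    have hsumB := le_sum_of_isPosition hposB
    refine ⟨?_, fun _ => Or.inr ⟨h1, h2, h3, Or.inr ⟨c, hc0, rfl⟩⟩⟩
    rw [nset_blowOne q B hsumB]
    exact le_trans (betaL_image_psiC_le hsumB hneB) hβB.le

/-- The β-NEUTRAL STEPS of Σ**_q from `X` to `Y`. -/
def IsNeutralStep (q : ℕ) (X Y : MvPowerSeries (Fin 2) k) : Prop :=
  (IsPermissibleOne q X ∧ Y = divOne q X) ∨
  (¬ IsPermissibleOne q X ∧ ¬ IsPermissibleTwo q X ∧ ¬ HasGraphCurve q X ∧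
    (Y = blowOne q X ∨ ∃ c : k, c ≠ 0 ∧ Y = blowOne q (clean q (shear (C c) X))))

/-- β-STABILISATION: along every infinite Σ**_q-chain of clean non-zero positions `β` is eventually constant and from then on every step is
β-neutral. -/
theorem exists_neutral_tail {q : ℕ} (hq : 0 < q) (A : ℕ → MvPowerSeries (Fin 2) k)
    (hA : ∀ m, IsClean q (A m) ∧ IsPosition q (A m) ∧ A m ≠ 0 ∧ A (m + 1) ∈ succ q (A m)) :
    ∃ M : ℕ, ∀ m, M ≤ m → betaL (nset (A m)) = betaL (nset (A M)) ∧ IsNeutralStep q (A m) (A (m + 1)) := by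
  set f : ℕ → ℕ := fun m => betaL (nset (A m)) with hf
  have hstep : ∀ m, f (m + 1) ≤ f m ∧ (f (m + 1) = f m → IsNeutralStep q (A m) (A (m + 1))) := by
    intro m
    obtain ⟨hcl, hpos, hne, hsucc⟩ := hA m
    exact betaL_succ_le hq (A m) hcl hpos hne (A (m + 1)) hsucc
  have hanti : ∀ m n, m ≤ n → f n ≤ f m := by
    intro m n hmn
    induction n, hmn using Nat.le_induction with
    | base => exact le_rfl
    | succ n _ ih => exact le_trans (hstep n).1 ih
  obtain ⟨M, hM⟩ : ∃ M, ∀ n, f M ≤ f n := by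
    have hne : (Set.range f).Nonempty := ⟨f 0, 0, rfl⟩
    obtain ⟨M, hMv⟩ : sInf (Set.range f) ∈ Set.range f := Nat.sInf_mem hne
    exact ⟨M, fun n => by rw [hMv]; exact Nat.sInf_le ⟨n, rfl⟩⟩
  refine ⟨M, fun m hm => ?_⟩
  have hfm : f m = f M := le_antisymm (hanti M m hm) (hM m)
  have hfm1 : f (m + 1) = f M := le_antisymm (hanti M (m + 1) (by omega)) (hM (m + 1))
  exact ⟨hfm, (hstep m).2 (by rw [hfm1, hfm])⟩

end PureDescent

end Summit.ResolutionOfSingularities.ResolutionOfSingularities.Theorems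

end
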